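import Summits.BirchSwinnertonDyer.BirchSwinnertonDyer.Theorems.UniversalToricDescentThinCombDescentSpecialise
import Summits.BirchSwinnertonDyer.BirchSwinnertonDyer.Theorems.UniversalToricDescentThinCombDefs
import Summits.BirchSwinnertonDyer.BirchSwinnertonDyer.Theorems.SchneiderFreeAdditiveX3GordTwoBranchIMCDivOfKY
import Summits.BirchSwinnertonDyer.Rank1Residual.X11b.HalvesReceptacle
import Summits.BirchSwinnertonDyer.Rank1Residual.Additive.PotSupersingularClasses
import Literature.NumberTheory.EllipticCurves.HeegnerPointsKolyvaginTorsionProofs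
import HarnessLib

/-!
# Line `thin_comb` (v3) on the WALL `AdditiveSplitIMCInclusionAtThree` (stmt-BirchSwinnertonDyer-20395) — stub
# `stub_descent` (v3) CLOSED (`--supports stmt-BirchSwinnertonDyer-20395`; cell `pub/bsd-wall`, lead `cruxlead-20395` g3)

The registered skeleton v3 `Cruxes/AdditiveSplitIMCInclusionAtThree/Lines/thin_comb.lean` (sha16 e0c630fc4f1e4ea9) has the glue stub
`stub_descent`: in a v2 frame `(κ₁, κ₂; γ₁, γ₂, k)` of the `ℤ₃²`-tower of `K` (`κ γ₁ = κ γ`, `κ γ₂ = κ γ^{3^k}`), if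
`X₂ = X_{∅ at 𝔭, nr at 𝔭′}(E/K̃_∞)` is finitely generated and torsion over `Λ₂ = ℤ₃⟦T₂⟧⟦T₁⟧` with every pseudo-null
submodule finite (S3n′) and `ch_{Λ₂}(X₂) = (g)`, then for `L₂ ∈ Λ₂(R₀)`, `L ∈ R₀⟦T⟧` with `g ∣ L₂` and
`L₂ ≡ u·L(T₁) (mod (T₂ − ((1+T₁)^{3^k} − 1)))`: `(L) ⊆ ch_Λ(X_ac(E/K_∞)_{∅})·R₀⟦T⟧`.

Proof = the lead's descent chain: `E(K)[3] = 0` (`torsionBy_eq_bot_of_isImaginaryQuadratic`, `ρ̄` onto, `K` quadratic);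
`DescentSpecialise.span_spec_le_charIdeal` (control along `pairKer ≤ ker κ`, semilinear along
`φ = spec (3^k) : T₁ ↦ T, 1 + T₂ ↦ (1+T)^{3^k}`, shear `α`, tree `T₁ ↦ 0` specialisation under S3n′) gives
`(φ g) ⊆ ch_Λ(X_ac)` over `ℤ₃`; over `R₀` the same substitution `φ` (`TwoVarSubst.spec`, natural in the coefficient
ring) kills `T₂ − ((1+T₁)^{3^k} − 1)` and retracts `L ↦ L(T₁)`, so `φ(G) ∣ φ(L₂) = φ(u)·L` with `φ(G) = (φ g)·R₀`.

Nothing else of the line is addressed; BSD is not proved by any of this.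
-/

set_option linter.dupNamespace false
set_option autoImplicit false

noncomputable section

open scoped Classical

namespace Summit.BirchSwinnertonDyer.BirchSwinnertonDyer.Theorems.UniversalToricDescentThinCombLine

open NumberField IsDedekindDomain Field
open Literature.NumberTheory.EllipticCurves
open Summit.BirchSwinnertonDyer.BirchSwinnertonDyer.Theorems.UniversalToricDescentThinComb

/-- The generator `T₂ − ((1+T₁)^e − 1)` of the anticyclotomic line of a v2 frame, in the `ThinCombDefs` names, is the
kernel generator of `TwoVarSubst.spec e`. [folklore] -/
theorem T₂_sub_eq {𝒪 : Type*} [CommRing 𝒪] (e : ℕ) :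
    T₂ 𝒪 - ((1 + T₁ 𝒪) ^ e - 1) = PowerSeries.C PowerSeries.X - ((1 + PowerSeries.X) ^ e - 1) := rfl

/-- **`stub_descent` of line `thin_comb` v3, closed** (verbatim the registered signature, `p = 3`).
[cite: SkinnerUrban2014, §3.2.7–3.2.8 and Cor. 3.2.9 (pp. 23–24)] [cite: Greenberg2016, Prop. 4.1.1]
[cite: Delbourgo2008, Ch. X Lemma 10.5] [cite: GrossLMS1991, §2 (after (2.2))] -/
theorem stub_descent :
    ∀ (W : WeierstrassCurve ℚ) [W.IsElliptic] [W.IsGloballyMinimal] (K : Type) [Field K] [NumberField K],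
    Summit.BirchSwinnertonDyer.Rank1Residual.Additive.ClassO6 W 3 → W.HasSurjectiveModNGaloisRep 3 →
    IsImaginaryQuadratic K →
    ∀ (κ : ZpExtension K 3), κ.IsAnticyclotomic → ∀ (γ : Field.absoluteGaloisGroup K) [Fact (κ.IsTopGenerator γ)]
      (𝔭 : HeightOneSpectrum (𝓞 K)), ((3 : ℕ) : 𝓞 K) ∈ 𝔭.asIdeal →
    ∀ (𝔭' : HeightOneSpectrum (𝓞 K)), ((3 : ℕ) : 𝓞 K) ∈ 𝔭'.asIdeal → 𝔭' ≠ 𝔭 →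
    ∀ (κ₁ κ₂ : ZpExtension K 3) (γ₁ γ₂ : Field.absoluteGaloisGroup K) (k : ℕ)
      [Fact (ZpExtension.IsTopGeneratorPair κ₁ κ₂ γ₁ γ₂)],
    (∀ v : HeightOneSpectrum (𝓞 K), v ≠ 𝔭 → ∀ 𝔓 ∈ v.primesAbove,
        𝔓.inertia (Field.absoluteGaloisGroup K) ≤ κ₁.kerSubgroup) →
    ZpExtension.pairKer κ₁ κ₂ ≤ κ.kerSubgroup → γ₁ * γ⁻¹ ∈ κ.kerSubgroup → γ₂ * (γ ^ (3 ^ k))⁻¹ ∈ κ.kerSubgroup →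
    Module.Finite (IwasawaAlgebra₂ 3) ((W.baseChange K).XGr₂ 3 κ₁ κ₂ 𝔭' γ₁ γ₂) →
    Module.IsTorsion (IwasawaAlgebra₂ 3) ((W.baseChange K).XGr₂ 3 κ₁ κ₂ 𝔭' γ₁ γ₂) →
    (∀ N : Submodule (IwasawaAlgebra₂ 3) ((W.baseChange K).XGr₂ 3 κ₁ κ₂ 𝔭' γ₁ γ₂),
      Literature.NumberTheory.EllipticCurves.Module.IsPseudoNull (IwasawaAlgebra₂ 3) N → Finite N) →
    ∀ (g : IwasawaAlgebra₂ 3),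
      Literature.NumberTheory.EllipticCurves.Module.charIdeal (IwasawaAlgebra₂ 3)
        ((W.baseChange K).XGr₂ 3 κ₁ κ₂ 𝔭' γ₁ γ₂) = Ideal.span {g} →
    ∀ (L₂ : PowerSeries (PowerSeries (unrIntegers 3))) (L : UnrSeries 3),
      PowerSeries.map (PowerSeries.map (Summit.BirchSwinnertonDyer.Rank1Residual.X11b.Halves.toUnr 3)) g ∣ L₂ →
      (∃ u : (PowerSeries (PowerSeries (unrIntegers 3)))ˣ,
        L₂ - u * PowerSeries.map (PowerSeries.C (R := unrIntegers 3)) L ∈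
          Ideal.span {T₂ (unrIntegers 3) - ((1 + T₁ (unrIntegers 3)) ^ (3 ^ k) - 1)}) →
      Ideal.span {L} ≤ (Summit.BirchSwinnertonDyer.Rank1Residual.X11b.AcSelmer.XAc.charIdeal (W.baseChange K) 3 κ 𝔭' ∅ γ).map
        (PowerSeries.map (Summit.BirchSwinnertonDyer.Rank1Residual.X11b.Halves.toUnr 3)) := by
  intro W _ _ K _ _ _hO6 hsurj hK κ _hκ γ _ 𝔭 _h3 𝔭' _h3' _hne κ₁ κ₂ γ₁ γ₂ k _ _hur₁ hker hγ₁ hγ₂ hfin htors hPN g hg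
    L₂ L hdvd hcong
  -- (1) `E(K)[3] = 0`
  have htor3 := torsionBy_eq_bot_of_isImaginaryQuadratic W K hK (Fact.out : Nat.Prime 3) (by decide) hsurj
  have hKp : ∀ P : (W.baseChange K).toAffine.Point, 3 • P = 0 → P = 0 := fun P hP => by
    have hmem : P ∈ AddSubgroup.torsionBy (W.baseChange K).toAffine.Point ((3 : ℕ) : ℤ) :=
      AddSubgroup.torsionBy.nsmul_iff.mpr hP
    rw [htor3] at hmem
    exact AddSubgroup.mem_bot.mp hmem
  -- (2) the `ℤ₃`-level descent
  haveI := hfin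
  have hZp := DescentSpecialise.span_spec_le_charIdeal (W.baseChange K) 3 κ₁ κ₂ κ 𝔭' γ₁ γ₂ γ hker (e := 3 ^ k)
    hγ₁ hγ₂ hKp htors hPN hg
  -- (3) the `R₀`-level bookkeeping
  set ψ := TwoVarSubst.spec (R := unrIntegers 3) (3 ^ k) with hψ
  set G := PowerSeries.map (PowerSeries.map (Summit.BirchSwinnertonDyer.Rank1Residual.X11b.Halves.toUnr 3)) g with hG
  have hψf : ψ (T₂ (unrIntegers 3) - ((1 + T₁ (unrIntegers 3)) ^ (3 ^ k) - 1)) = 0 := by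
    rw [T₂_sub_eq]; exact TwoVarSubst.spec_ker_gen (3 ^ k)
  have hψL : ψ (PowerSeries.map (PowerSeries.C (R := unrIntegers 3)) L) = L := TwoVarSubst.spec_toOuter (3 ^ k) L
  obtain ⟨u, hu⟩ := hcong
  obtain ⟨c, hc⟩ := Ideal.mem_span_singleton'.mp hu
  have h1 : ψ L₂ = ψ u * L := by
    have := congrArg ψ hc
    rw [map_mul, hψf, mul_zero, map_sub, map_mul, hψL] at this
    exact (sub_eq_zero.mp this.symm)
  have hψG : ψ G = PowerSeries.map (Summit.BirchSwinnertonDyer.Rank1Residual.X11b.Halves.toUnr 3)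
      (TwoVarSubst.spec (3 ^ k) g) := (TwoVarSubst.map_spec (3 ^ k) _ g).symm
  have hGd : ψ G ∣ ψ u * L := h1 ▸ map_dvd ψ hdvd
  have hunit : IsUnit (ψ u) := (Units.isUnit u).map ψ
  have hLmem : L ∈ Ideal.span {PowerSeries.map (Summit.BirchSwinnertonDyer.Rank1Residual.X11b.Halves.toUnr 3)
      (TwoVarSubst.spec (3 ^ k) g)} := by
    rw [← hψG, Ideal.mem_span_singleton]
    exact (hunit.dvd_mul_left).mp hGd
  -- (4) conclude
  rw [Ideal.span_singleton_le_iff_mem, SchneiderFree.xac_charIdeal_eq_literature]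
  have hmap := Ideal.map_mono (f := PowerSeries.map (Summit.BirchSwinnertonDyer.Rank1Residual.X11b.Halves.toUnr 3)) hZp
  rw [Ideal.map_span, Set.image_singleton] at hmap
  exact hmap hLmem

end Summit.BirchSwinnertonDyer.BirchSwinnertonDyer.Theorems.UniversalToricDescentThinCombLine

end
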